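/-
Copyright (c) 2026 the pub-hodgecm-mathlib formalisation cell (harness21).  Prover seat hodgecm-mathlib-F0P3a-p02 (g19): LH3 «Transf» road,
brick (GLUE-X-gen), sequel file (dealer LH3-plan (g2) ruling (6) 2026-09-02; split with F0P3a-p09 (g5) who cuts the chart dress).
-/
import Literature.Analysis.Calculus.SmoothGluingAcrossHyperplane
import HarnessLib

/-!
# Smooth gluing across a hyperplane — the ray forms (consumer statements) and riders

Sequel of `SmoothGluingAcrossHyperplane.lean` (everything PROVED; no definition, no named fact, no `sorry`).  There the glue
`extendFrom (U ∩ {ℓ ≠ a}) f` of a function `C^∞` off the wall `{ℓ = a}` with locally bounded jets was shown to be `C^∞` on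
`U` as soon as, at every wall point and every order, the two one-sided limits of `Dⁿ f` agree
(`contDiffOn_extendFrom_of_oneSidedLimits_eq`).  Here the agreement is read off ONE transversal ray `x + t • v` (`ℓ v ≠ 0`),
which is how jump relations of orbital integrals are stated (D. Shelstad, Compositio Math. 39 (1979), §4, Prop. 4.5 and the
proof of Thm. 4.7; A. Bouaziz, Ann. Sci. ÉNS 27 (1994), §3.2 (I₃) p. 580: one-sided limits `t → 0±` of the derivatives along
`s·exp(t i H_α)`):
* `contDiffOn_extendFrom_of_tendsto_iteratedFDeriv_ray` — the full `n`-th derivative has the same limit along the ray from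
  both sides;
* `contDiffOn_extendFrom_of_tendsto_iteratedFDeriv_ray_apply` — idem, tested on every word of directions `m : Fin n → E`;
* `contDiffOn_extendFrom_of_tendsto_iteratedFDeriv_ray_basis` — idem, tested only on the words drawn from a basis `b` of `E`
  (`Module.Basis.ext_multilinear`: a multilinear map is determined by its values on basis words; no finite-dimensionality of
  `E` is needed, only a basis).
The reduction: the one-sided limits WITHIN the open sides exist by the bounded-jets hypothesis (main file), the ray runs inside
the side, so the ray limit IS the one-sided limit (`tendsto_nhds_unique`); reversing `v` exchanges the two sides
(`tendsto_ray_neg_iff`).  RIDERS (§5): at a wall point the jets of the glue are the limits of the jets of `f` from the open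
complement (`tendsto_iteratedFDeriv_of_contDiffOn_extendFrom`), and every jet of a `C^∞` function on an open set is bounded on
compact subsets (`bddAbove_norm_iteratedFDeriv_image_of_contDiffOn`, Bouaziz's (I₁) shape for the glued family).

## References
* A. Bouaziz, *Intégrales orbitales sur les groupes de Lie réductifs*, Ann. Sci. ÉNS (4) 27 (1994), §3.1–3.2 pp. 579–580.
* D. Shelstad, *Characters and inner forms of a quasi-split group over `ℝ`*, Compositio Math. 39 (1979), §4 pp. 22–31.
-/

noncomputable section

open Set Filter Metric Function
open scoped Topology NNReal ContDiff

namespace Literature.Analysis.Calculus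

variable {E : Type*} [NormedAddCommGroup E] [NormedSpace ℝ E]
  {F : Type*} [NormedAddCommGroup F] [NormedSpace ℝ F] [CompleteSpace F]

/-! ### §4 Consumer forms: the agreement read off one transversal ray -/

section Ray

variable (ℓ : E →L[ℝ] ℝ) (a : ℝ)

omit [CompleteSpace F] in
/-- Reversing the transversal direction exchanges the two one-sided ray limits (`x + t • (-v) = x + (-t) • v`).
[cite: Bouaziz1994IntegralesOrbitales, §3.2 (I₁)–(I₂) p. 579] -/
theorem tendsto_ray_neg_iff {X : Type*} [TopologicalSpace X] (φ : E → X) (x v : E) (l : Filter X) :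
    Tendsto (fun t : ℝ => φ (x + t • (-v))) (𝓝[>] 0) l ↔ Tendsto (fun t : ℝ => φ (x + t • v)) (𝓝[<] 0) l := by
  have key : (fun t : ℝ => φ (x + t • (-v))) = (fun t : ℝ => φ (x + t • v)) ∘ Neg.neg := by
    ext t; simp [smul_neg, neg_smul]
  constructor
  · intro h
    have h1 : Tendsto Neg.neg (𝓝[<] (0 : ℝ)) (𝓝[>] (0 : ℝ)) := by simpa using tendsto_neg_nhdsLT (a := (0 : ℝ))
    have h2 := h.comp h1
    rw [key] at h2
    have : ((fun t : ℝ => φ (x + t • v)) ∘ Neg.neg) ∘ Neg.neg = fun t : ℝ => φ (x + t • v) := by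
      ext t; simp
    rwa [this] at h2
  · intro h
    have h1 : Tendsto Neg.neg (𝓝[>] (0 : ℝ)) (𝓝[<] (0 : ℝ)) := by simpa using tendsto_neg_nhdsGT (a := (0 : ℝ))
    rw [key]
    exact h.comp h1

/-- **SMOOTH GLUING ACROSS A HYPERPLANE (ray form).**  As `contDiffOn_extendFrom_of_oneSidedLimits_eq`, with the agreement
hypothesis read off ONE transversal ray: at every wall point `x` and every order `n`, the full `n`-th derivative of `f` has
the SAME limit along `x + t • v` for `t → 0⁺` and for `t → 0⁻` (`ℓ v ≠ 0`).  Then `extendFrom (U ∩ {ℓ ≠ a}) f` is `C^∞` on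
`U`. [cite: Bouaziz1994IntegralesOrbitales, §3.2 (I₁)–(I₂) p. 579] -/
theorem contDiffOn_extendFrom_of_tendsto_iteratedFDeriv_ray {v : E} (hv : ℓ v ≠ 0) {U : Set E} (hU : IsOpen U)
    {f : E → F} (hf : ContDiffOn ℝ ∞ f (U ∩ {y | ℓ y ≠ a}))
    (hb : ∀ x ∈ U, ℓ x = a → ∀ n : ℕ, ∃ C : ℝ, ∀ᶠ y in 𝓝 x, ℓ y ≠ a → ‖iteratedFDeriv ℝ n f y‖ ≤ C)
    (hj : ∀ x ∈ U, ℓ x = a → ∀ n : ℕ, ∃ l : E [×n]→L[ℝ] F,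
      Tendsto (fun t : ℝ => iteratedFDeriv ℝ n f (x + t • v)) (𝓝[>] 0) (𝓝 l) ∧
      Tendsto (fun t : ℝ => iteratedFDeriv ℝ n f (x + t • v)) (𝓝[<] 0) (𝓝 l)) :
    ContDiffOn ℝ ∞ (extendFrom (U ∩ {y | ℓ y ≠ a}) f) U := by
  refine contDiffOn_extendFrom_of_oneSidedLimits_eq ℓ a hv hU hf hb fun x hxU hxa n l₁ l₂ h₁ h₂ => ?_
  obtain ⟨l, hlp, hlm⟩ := hj x hxU hxa n
  rcases lt_or_gt_of_ne hv with hneg | hpos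
  · -- `ℓ v < 0`: the ray `t > 0` runs into `{ℓ < a}`, the ray `t < 0` into `{a < ℓ}`
    have hv' : 0 < ℓ (-v) := by simpa using hneg
    have r₁ : Tendsto (fun t : ℝ => x + t • (-v)) (𝓝[>] 0) (𝓝[{y | a < ℓ y}] x) := by
      simpa [univ_inter] using tendsto_ray_nhdsWithin_lt_apply hxa hv' univ_mem
    have r₂ : Tendsto (fun t : ℝ => x + t • (-v)) (𝓝[<] 0) (𝓝[{y | ℓ y < a}] x) := by
      simpa [univ_inter] using tendsto_ray_nhdsWithin_apply_lt hxa hv' univ_mem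
    have e₁ : l₁ = l :=
      tendsto_nhds_unique (h₁.comp r₁) ((tendsto_ray_neg_iff (iteratedFDeriv ℝ n f) x v _).2 hlm)
    have e₂ : l₂ = l := by
      refine tendsto_nhds_unique (h₂.comp r₂) ?_
      have := (tendsto_ray_neg_iff (iteratedFDeriv ℝ n f) x (-v) (𝓝 l)).1 (by simpa using hlp)
      exact this
    rw [e₁, e₂]
  · have r₁ : Tendsto (fun t : ℝ => x + t • v) (𝓝[>] 0) (𝓝[{y | a < ℓ y}] x) := by
      simpa [univ_inter] using tendsto_ray_nhdsWithin_lt_apply hxa hpos univ_mem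
    have r₂ : Tendsto (fun t : ℝ => x + t • v) (𝓝[<] 0) (𝓝[{y | ℓ y < a}] x) := by
      simpa [univ_inter] using tendsto_ray_nhdsWithin_apply_lt hxa hpos univ_mem
    exact (tendsto_nhds_unique (h₁.comp r₁) hlp).trans (tendsto_nhds_unique (h₂.comp r₂) hlm).symm

/-- **SMOOTH GLUING ACROSS A HYPERPLANE (ray form, tested on words of directions).**  The same, with the ray limits of the
`n`-th derivative tested on every word `m : Fin n → E`: for each word the two one-sided limits of
`t ↦ Dⁿf(x + t • v) m` exist and agree. [cite: Bouaziz1994IntegralesOrbitales, §3.2 (I₁)–(I₂) p. 579] -/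
theorem contDiffOn_extendFrom_of_tendsto_iteratedFDeriv_ray_apply {v : E} (hv : ℓ v ≠ 0) {U : Set E} (hU : IsOpen U)
    {f : E → F} (hf : ContDiffOn ℝ ∞ f (U ∩ {y | ℓ y ≠ a}))
    (hb : ∀ x ∈ U, ℓ x = a → ∀ n : ℕ, ∃ C : ℝ, ∀ᶠ y in 𝓝 x, ℓ y ≠ a → ‖iteratedFDeriv ℝ n f y‖ ≤ C)
    (hj : ∀ x ∈ U, ℓ x = a → ∀ (n : ℕ) (m : Fin n → E), ∃ l : F,
      Tendsto (fun t : ℝ => iteratedFDeriv ℝ n f (x + t • v) m) (𝓝[>] 0) (𝓝 l) ∧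
      Tendsto (fun t : ℝ => iteratedFDeriv ℝ n f (x + t • v) m) (𝓝[<] 0) (𝓝 l)) :
    ContDiffOn ℝ ∞ (extendFrom (U ∩ {y | ℓ y ≠ a}) f) U := by
  refine contDiffOn_extendFrom_of_oneSidedLimits_eq ℓ a hv hU hf hb fun x hxU hxa n l₁ l₂ h₁ h₂ => ?_
  -- WLOG `0 < ℓ v` (replace `v` by `-v`)
  obtain ⟨w, hw, hjw⟩ : ∃ w : E, 0 < ℓ w ∧ ∀ m : Fin n → E, ∃ l : F,
      Tendsto (fun t : ℝ => iteratedFDeriv ℝ n f (x + t • w) m) (𝓝[>] 0) (𝓝 l) ∧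
      Tendsto (fun t : ℝ => iteratedFDeriv ℝ n f (x + t • w) m) (𝓝[<] 0) (𝓝 l) := by
    rcases lt_or_gt_of_ne hv with hneg | hpos
    · refine ⟨-v, by simpa using hneg, fun m => ?_⟩
      obtain ⟨l, hlp, hlm⟩ := hj x hxU hxa n m
      refine ⟨l, (tendsto_ray_neg_iff (fun y => iteratedFDeriv ℝ n f y m) x v _).2 hlm, ?_⟩
      exact (tendsto_ray_neg_iff (fun y => iteratedFDeriv ℝ n f y m) x (-v) (𝓝 l)).1 (by simpa using hlp)
    · exact ⟨v, hpos, hj x hxU hxa n⟩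
  have r₁ : Tendsto (fun t : ℝ => x + t • w) (𝓝[>] 0) (𝓝[{y | a < ℓ y}] x) := by
    simpa [univ_inter] using tendsto_ray_nhdsWithin_lt_apply hxa hw univ_mem
  have r₂ : Tendsto (fun t : ℝ => x + t • w) (𝓝[<] 0) (𝓝[{y | ℓ y < a}] x) := by
    simpa [univ_inter] using tendsto_ray_nhdsWithin_apply_lt hxa hw univ_mem
  ext m
  obtain ⟨l, hlp, hlm⟩ := hjw m
  have ev : Continuous fun L : E [×n]→L[ℝ] F => L m := (ContinuousMultilinearMap.apply ℝ (fun _ : Fin n => E) F m).continuous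
  have e₁ : l₁ m = l := tendsto_nhds_unique ((ev.tendsto l₁).comp (h₁.comp r₁)) hlp
  have e₂ : l₂ m = l := tendsto_nhds_unique ((ev.tendsto l₂).comp (h₂.comp r₂)) hlm
  rw [e₁, e₂]

/-- **SMOOTH GLUING ACROSS A HYPERPLANE (ray form, tested on basis words).**  The same, with the ray limits of the `n`-th
derivative tested only on the words drawn from a basis `b` of `E` (a continuous multilinear map is determined by its values
on basis words). [cite: Bouaziz1994IntegralesOrbitales, §3.2 (I₁)–(I₂) p. 579] -/
theorem contDiffOn_extendFrom_of_tendsto_iteratedFDeriv_ray_basis {ι : Type*} (b : Module.Basis ι ℝ E) {v : E} (hv : ℓ v ≠ 0)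
    {U : Set E} (hU : IsOpen U) {f : E → F} (hf : ContDiffOn ℝ ∞ f (U ∩ {y | ℓ y ≠ a}))
    (hb : ∀ x ∈ U, ℓ x = a → ∀ n : ℕ, ∃ C : ℝ, ∀ᶠ y in 𝓝 x, ℓ y ≠ a → ‖iteratedFDeriv ℝ n f y‖ ≤ C)
    (hj : ∀ x ∈ U, ℓ x = a → ∀ (n : ℕ) (k : Fin n → ι), ∃ l : F,
      Tendsto (fun t : ℝ => iteratedFDeriv ℝ n f (x + t • v) fun i => b (k i)) (𝓝[>] 0) (𝓝 l) ∧
      Tendsto (fun t : ℝ => iteratedFDeriv ℝ n f (x + t • v) fun i => b (k i)) (𝓝[<] 0) (𝓝 l)) :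
    ContDiffOn ℝ ∞ (extendFrom (U ∩ {y | ℓ y ≠ a}) f) U := by
  refine contDiffOn_extendFrom_of_oneSidedLimits_eq ℓ a hv hU hf hb fun x hxU hxa n l₁ l₂ h₁ h₂ => ?_
  obtain ⟨w, hw, hjw⟩ : ∃ w : E, 0 < ℓ w ∧ ∀ k : Fin n → ι, ∃ l : F,
      Tendsto (fun t : ℝ => iteratedFDeriv ℝ n f (x + t • w) fun i => b (k i)) (𝓝[>] 0) (𝓝 l) ∧
      Tendsto (fun t : ℝ => iteratedFDeriv ℝ n f (x + t • w) fun i => b (k i)) (𝓝[<] 0) (𝓝 l) := by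
    rcases lt_or_gt_of_ne hv with hneg | hpos
    · refine ⟨-v, by simpa using hneg, fun k => ?_⟩
      obtain ⟨l, hlp, hlm⟩ := hj x hxU hxa n k
      refine ⟨l, (tendsto_ray_neg_iff (fun y => iteratedFDeriv ℝ n f y fun i => b (k i)) x v _).2 hlm, ?_⟩
      exact (tendsto_ray_neg_iff (fun y => iteratedFDeriv ℝ n f y fun i => b (k i)) x (-v) (𝓝 l)).1 (by simpa using hlp)
    · exact ⟨v, hpos, hj x hxU hxa n⟩
  have r₁ : Tendsto (fun t : ℝ => x + t • w) (𝓝[>] 0) (𝓝[{y | a < ℓ y}] x) := by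
    simpa [univ_inter] using tendsto_ray_nhdsWithin_lt_apply hxa hw univ_mem
  have r₂ : Tendsto (fun t : ℝ => x + t • w) (𝓝[<] 0) (𝓝[{y | ℓ y < a}] x) := by
    simpa [univ_inter] using tendsto_ray_nhdsWithin_apply_lt hxa hw univ_mem
  apply ContinuousMultilinearMap.toMultilinearMap_injective
  refine Module.Basis.ext_multilinear (fun _ : Fin n => b) fun k => ?_
  obtain ⟨l, hlp, hlm⟩ := hjw k
  have ev : Continuous fun L : E [×n]→L[ℝ] F => L fun i => b (k i) :=
    (ContinuousMultilinearMap.apply ℝ (fun _ : Fin n => E) F fun i => b (k i)).continuous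
  have e₁ : l₁ (fun i => b (k i)) = l := tendsto_nhds_unique ((ev.tendsto l₁).comp (h₁.comp r₁)) hlp
  have e₂ : l₂ (fun i => b (k i)) = l := tendsto_nhds_unique ((ev.tendsto l₂).comp (h₂.comp r₂)) hlm
  change l₁ (fun i => b (k i)) = l₂ fun i => b (k i)
  rw [e₁, e₂]

end Ray

/-! ### §5 Riders on the glued jets: values at the wall, boundedness on compact sets -/

section Riders

variable (ℓ : E →L[ℝ] ℝ) (a : ℝ)

omit [CompleteSpace F] in
/-- **RIDER: the jets of a `C^∞`-on-`U` glue at a wall point are the limits of the jets of `f` from the open complement of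
the wall.** [cite: Bouaziz1994IntegralesOrbitales, §3.2 (I₁)–(I₂) p. 579] -/
theorem tendsto_iteratedFDeriv_of_contDiffOn_extendFrom {U : Set E} (hU : IsOpen U) {f : E → F}
    (hf : ContDiffOn ℝ ∞ f (U ∩ {y | ℓ y ≠ a})) (hg : ContDiffOn ℝ ∞ (extendFrom (U ∩ {y | ℓ y ≠ a}) f) U)
    {x : E} (hx : x ∈ U) (n : ℕ) :
    Tendsto (iteratedFDeriv ℝ n f) (𝓝[U ∩ {y | ℓ y ≠ a}] x)
      (𝓝 (iteratedFDeriv ℝ n (extendFrom (U ∩ {y | ℓ y ≠ a}) f) x)) := by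
  set s := U ∩ {y | ℓ y ≠ a}
  have hc : ContinuousOn (iteratedFDeriv ℝ n (extendFrom s f)) U :=
    (hg.continuousOn_iteratedFDerivWithin (m := n) (by exact_mod_cast le_top) hU.uniqueDiffOn).congr
      fun z hz => (iteratedFDerivWithin_of_isOpen n hU hz).symm
  have h1 : Tendsto (iteratedFDeriv ℝ n (extendFrom s f)) (𝓝[s] x) (𝓝 (iteratedFDeriv ℝ n (extendFrom s f) x)) :=
    ((hc x hx).mono_left (nhdsWithin_mono _ inter_subset_left))
  exact h1.congr' (eventually_of_mem self_mem_nhdsWithin fun z hz => iteratedFDeriv_extendFrom_eq_of_mem hU hf hz n)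

omit [CompleteSpace F] in
/-- **RIDER (Bouaziz's (I₁) shape for the glue): every jet of a function `C^∞` on the open set `U` is bounded on each compact
subset of `U`.** [cite: Bouaziz1994IntegralesOrbitales, §3.2 (I₁)–(I₂) p. 579] -/
theorem bddAbove_norm_iteratedFDeriv_image_of_contDiffOn {U : Set E} (hU : IsOpen U) {g : E → F}
    (hg : ContDiffOn ℝ ∞ g U) (n : ℕ) {K : Set E} (hK : IsCompact K) (hKU : K ⊆ U) :
    BddAbove ((fun y => ‖iteratedFDeriv ℝ n g y‖) '' K) := by
  have hc : ContinuousOn (iteratedFDeriv ℝ n g) U :=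
    (hg.continuousOn_iteratedFDerivWithin (m := n) (by exact_mod_cast le_top) hU.uniqueDiffOn).congr
      fun z hz => (iteratedFDerivWithin_of_isOpen n hU hz).symm
  exact (hK.image_of_continuousOn ((continuous_norm.comp_continuousOn hc).mono hKU)).bddAbove

omit [NormedSpace ℝ F] [CompleteSpace F] in
/-- **RIDER (uniqueness of the glue): a function continuous on `U` which agrees with `f` off the wall IS the glue on `U`**
(wall points are limits from the open complement, `ℓ ≠ 0`). [cite: Bouaziz1994IntegralesOrbitales, §3.2 (I₁)–(I₂) p. 579] -/
theorem eqOn_extendFrom_of_continuousOn {v : E} (hv : ℓ v ≠ 0) {U : Set E} (hU : IsOpen U) {f g : E → F}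
    (hg : ContinuousOn g U) (hgf : EqOn g f (U ∩ {y | ℓ y ≠ a})) :
    EqOn g (extendFrom (U ∩ {y | ℓ y ≠ a}) f) U := by
  obtain ⟨w, hw⟩ : ∃ w : E, 0 < ℓ w := by
    rcases lt_or_gt_of_ne hv with h | h
    · exact ⟨-v, by simpa using h⟩
    · exact ⟨v, h⟩
  intro x hx
  set s := U ∩ {y | ℓ y ≠ a}
  have hp : U ∩ {y | a < ℓ y} ⊆ s := fun z hz => ⟨hz.1, ne_of_gt hz.2⟩
  have hm : U ∩ {y | ℓ y < a} ⊆ s := fun z hz => ⟨hz.1, ne_of_lt hz.2⟩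
  have hcl : x ∈ closure s := by
    rcases subset_closure_union_closure (a := a) hw hU hx with h | h
    · exact closure_mono hp h
    · exact closure_mono hm h
  refine (extendFrom_eq hcl ?_).symm
  have h1 : Tendsto g (𝓝[s] x) (𝓝 (g x)) := (hg x hx).mono_left (nhdsWithin_mono _ inter_subset_left)
  exact h1.congr' (eventually_of_mem self_mem_nhdsWithin hgf)

/-- **SMOOTH GLUING, REPRESENTATIVE FORM.**  A function `g` CONTINUOUS on `U` that agrees off the wall with an `f` satisfying
the hypotheses of `contDiffOn_extendFrom_of_tendsto_iteratedFDeriv_ray_apply` is itself `C^∞` on `U` (it is the glue).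
[cite: Bouaziz1994IntegralesOrbitales, §3.2 (I₁)–(I₂) p. 579] -/
theorem contDiffOn_of_continuousOn_of_tendsto_iteratedFDeriv_ray_apply {v : E} (hv : ℓ v ≠ 0) {U : Set E}
    (hU : IsOpen U) {f g : E → F} (hg : ContinuousOn g U) (hgf : EqOn g f (U ∩ {y | ℓ y ≠ a}))
    (hf : ContDiffOn ℝ ∞ f (U ∩ {y | ℓ y ≠ a}))
    (hb : ∀ x ∈ U, ℓ x = a → ∀ n : ℕ, ∃ C : ℝ, ∀ᶠ y in 𝓝 x, ℓ y ≠ a → ‖iteratedFDeriv ℝ n f y‖ ≤ C)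
    (hj : ∀ x ∈ U, ℓ x = a → ∀ (n : ℕ) (m : Fin n → E), ∃ l : F,
      Tendsto (fun t : ℝ => iteratedFDeriv ℝ n f (x + t • v) m) (𝓝[>] 0) (𝓝 l) ∧
      Tendsto (fun t : ℝ => iteratedFDeriv ℝ n f (x + t • v) m) (𝓝[<] 0) (𝓝 l)) :
    ContDiffOn ℝ ∞ g U :=
  (contDiffOn_extendFrom_of_tendsto_iteratedFDeriv_ray_apply ℓ a hv hU hf hb hj).congr
    (eqOn_extendFrom_of_continuousOn ℓ a hv hU hg hgf)

omit [NormedSpace ℝ E] [NormedSpace ℝ F] [CompleteSpace F] in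
/-- **RIDER (locality of `extendFrom`): the glue at `x` only depends on the germ of the set at `x`** — if two sets have the
same filter `𝓝[·] x`, the two `extendFrom`'s agree at `x` (e.g. `U ∩ {ℓ ≠ a}` versus a globally defined regular set that
coincides with it near `x`). [cite: Bouaziz1994IntegralesOrbitales, §3.2 (I₁)–(I₂) p. 579] -/
theorem extendFrom_congr_of_nhdsWithin_eq {A B : Set E} {f : E → F} {x : E} (h : 𝓝[A] x = 𝓝[B] x) :
    extendFrom A f x = extendFrom B f x := by
  simp only [extendFrom, h]

end Riders

end Literature.Analysis.Calculus
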